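import Summits.AtomisticToContinuum.Crystallization.Theses.OneCentreSteepnessLadder

/-!
# Birth skeleton (BC3) for crux `LJDominationTwoThirds` — item stmt-AtomisticToContinuum-14452,
# route `OneCentreSteepnessLadder` (rank 5, open-problem), sub-problem `Crystallization`

Crux (verbatim the route decl, concluded BY NAME below by `LJDominationTwoThirds_of`): COERCIVE ONE-CENTRE DOMINATION
AT EXPONENT 6 OVER (2/3)-SEPARATED POINT SETS — there is an hcp scale `(a,h)` with `2a < 3h`, `6h < 5a` such that
`∀ η > 0 ∃ γ > 0 ∀ ε > 0 ∀ R₀ ∃ R ≥ R₀ ∃ g` (a rule `g(v, U)` reading a displacement `v` and a recentred range-`R`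
environment `U`, with `g v U = 0` for `‖v‖ > R`), antisymmetric on every `(2/3)`-separated `S ⊂ ℝ³`
(`g(y−x, U_x) = −g(x−y, U_y)`, `U_x = (S − x) ∩ B̄_R`), with `Φ^{≤R}_S(x) + T_g(x) ≤ Φ_hcp(a,h) + ε` at every `x ∈ S`
and `≤ Φ_hcp(a,h) + ε − γ` whenever the closed `5a/3`-neighbourhood of `x` is not `η`-matched (both ways, up to a linear
isometry) to `hcpStacking a h`; here `Φ^{≤R}_S(x) = Σ'_{y ∈ S, |y−x| ≤ R} φ₆(|y−x|)`, `φ₆(r) = 2r⁻⁶ − r⁻¹²`,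
`T_g(x) = Σ'_{y ∈ S} g(y − x, U_x)`, `Φ_hcp(a,h) = Σ'_{p ∈ hcpStacking a h} φ₆(‖p‖)`.

## The line: SURPLUS/DEFICIT LEDGER → ONE-ROUND LOCAL TRANSPORT → TAIL (the primal form of "one local transfer")

Write `Ψ(x) = Φ^{≤R₁}_S(x) − Φ_hcp(a,h) − ε' + γ·[x not η-matched]` for the EXCESS of a centre over the coercive
benchmark at an inner truncation radius `R₁` (`excess` below): `(Ψ x)₊` is SURPLUS that a transfer must ship away,
`(−Ψ x)₊` is DEFICIT that can absorb it.  The existence of ONE local antisymmetric rule achieving the pointwise bound is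
split into the physics (WHERE surplus and deficit sit, and how much) and the mechanism (HOW one local rule moves it):

* `stub_ledger` (XL / open — the crux's content at `q = 6`): at the right hcp scale, for every `η` a gain `γ`, and for
  every tolerance and every `R₀` a sharing radius `ρ` and a truncation radius `R₁ ≥ R₀` such that every centre with
  positive excess sees within `ρ` enough deficit, discounted by the surplus competing for it:
  `Ψ(x) > 0 ⇒ 1 ≤ Σ_{0<|y−x|≤ρ} (−Ψ y)₊ / Σ_{0<|z−y|≤ρ} (Ψ z)₊` — the solvability condition of the deficit-driven
  proportional rule.  (Contacts in `[2/3, 0.89)` have `φ₆ < 0` down to `φ₆(2/3) = −107` and finance themselves; the live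
  regime is the crux's: mildly crammed 13–14-fold / icosahedral centres, near-degenerate stackings, `γ(η) ≲ 6e-4·Φ`.)
* `stub_transfer` (M; a theorem): the LOCAL TRANSPORTATION LEMMA for an ABSTRACT excess functional `Ψ` that is local at
  radius `2ρ` through range-`R` environments (`R ≥ 2ρ`): the ledger condition on every `δ`-separated set ⇒ one rule `g`
  of range `ρ`, antisymmetric in exactly the crux's sense, with `Ψ S x + Σ'_y g(y−x, U_x) ≤ 0` everywhere.  The rule:
  a deficit centre `y` hands each surplus centre `x` with `0 < |x−y| ≤ ρ` the share `(−Ψ y)₊ (Ψ x)₊ / Σ_{0<|z−y|≤ρ} (Ψ z)₊`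
  — computable from `U_x` alone by locality, never more than the deficit in total, at least the surplus by the ledger.
* `stub_tail` (S/M; a theorem, routine): uniform truncation tail on `(2/3)`-separated sets,
  `Φ^{≤R}_S(x) ≤ Φ^{≤R₁}_S(x) + ε` for `R ≥ R₁ ≥ R₁₀(ε)` (landed dyadic-shell bound `tsum_inv_pow_le_of_separated`, k = 3).

`compose` (PROVED, ≈ 40 lines + two locality lemmas) is the real assembly: given `η` take `γ` from the ledger; given
`ε, R₀` take `R₁₀(ε/2)` from the tail, the ledger's `ρ, R₁ ≥ max(R₀, R₁₀, 5a/3 + η)` at tolerance `ε/2`, and the range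
`R := 2ρ + R₁`; the concrete excess functional is local at radius `2ρ` through range-`R` environments (`excess_local` =
reindexing of the radial `tsum` under translation, `tsum_radial_env`, + transport of the two-way matching predicate,
`matched_local`, which reads only `B̄(x, 5a/3 + η)`), so the transportation lemma yields `g` (range `ρ ≤ R`, antisymmetry
verbatim), and `tail + (excess + T_g ≤ 0)` give both clauses of the crux.  `LJDominationTwoThirds_of : LJDominationTwoThirds`
is `compose stub_ledger stub_transfer stub_tail` (the registered one-line signatures are DEFINITIONALLY the readable
hypotheses of `compose`; the `example`s at the end certify this by `rfl`); the hypothesis form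
`stub-sigs → LJDominationTwoThirds` is the sorry-free `example` above it.  The only `sorry`s of this file are the three
`stub_*` (lean check rc 0, sorries 3 = stubs; `#h21_check_skeleton`: ok, closed = false).

Rejected cuts (why this one): (i) the MULTIPLICITY-WEIGHTED pointwise ledger `M(ρ)·(Ψ x)₊ ≤ Σ_{B_ρ(x)} (−Ψ)₊`
(surplus-driven sharing) — plausibly FALSE in the near-equality regime (planner heuristic): hcp sites are not
centrosymmetric (site group D₃ₕ), so the first-order excess of a smooth strain-gradient field can ALTERNATE in sign between the
two hcp sublattices; the `M`-form then loses the factor `M(1)/6 ≈ 10` against the six out-of-layer neighbours that carry the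
compensating deficit, while the proportional form passes (`6(b−ε)/(6(b+ε)) < 1`); (ii) the DUAL cut (averaged domination under unimodular laws + Hahn–Banach ⇒ a local transfer;
the refuter's evidence note on the twin item 14327, §6) — the right theorem but not typable over tree declarations in one
shot (unimodular measures on configurations); (iii) "optimal scale + domination at every optimal scale" — a costume.
Disproof.lean: none exists for this crux (`ledger crux ls`: no workfiles); negatives index / evidence: the only attached
evidence (refuter, twin 14327) argues finite range is free once `R` follows `ε` and caps `γ(η) ≲ 5.8e-4`; the skeleton
keeps `γ, ρ, R₁, R` existential in that order and fixes no constant, so neither remark bites a stub.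

Registered signatures are ONE-LINE and fully qualified (restatable verbatim in a `Theorems/`-side `--supports` file under
`open scoped Classical`); the readable `def`s (`Sep`, `env`, `truncSum`, `hcpValue`, `Matched`, `excess`) are proof-side
abbreviations and documentation, definitionally equal to the inlined text (sanity `example`s at the end).
-/

noncomputable section

namespace Summit.AtomisticToContinuum.Crystallization.Cruxes.LJDominationTwoThirds.Birth

open scoped BigOperators Classical
open Literature.MathematicalPhysics.StatisticalMechanics

/-! ## Readable names (documentation and proof-side abbreviations; the registered stubs INLINE them verbatim) -/

/-- `δ`-separation of a point set (the crux's admissibility hypothesis at `δ = 2/3`). -/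
def Sep (δ : ℝ) (S : Set (EuclideanSpace ℝ (Fin 3))) : Prop := ∀ x ∈ S, ∀ y ∈ S, x ≠ y → δ ≤ dist x y

/-- The recentred range-`R` environment of `x` in `S` — the second argument the crux hands to a rule `g`. -/
def env (S : Set (EuclideanSpace ℝ (Fin 3))) (x : (EuclideanSpace ℝ (Fin 3))) (R : ℝ) : Set (EuclideanSpace ℝ (Fin 3)) :=
  ((fun z : (EuclideanSpace ℝ (Fin 3)) => z - x) '' S) ∩ Metric.closedBall (0 : (EuclideanSpace ℝ (Fin 3))) R

/-- Truncated one-centre functional `Φ^{≤R₁}_S(w) = Σ'_{b ∈ S, |b−w| ≤ R₁} φ₆(|b − w|)`, `φ₆(r) = 2r⁻⁶ − r⁻¹²`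
(the `b = w` term is `φ₆(0) = 0` by `0⁻¹ = 0`), written exactly as in the crux. -/
def truncSum (R₁ : ℝ) (S : Set (EuclideanSpace ℝ (Fin 3))) (w : (EuclideanSpace ℝ (Fin 3))) : ℝ :=
  (∑' b : ↥S, (if dist w (b : EuclideanSpace ℝ (Fin 3)) ≤ R₁ then (2 * (dist w (b : EuclideanSpace ℝ (Fin 3)))⁻¹ ^ 6 - (dist w (b : EuclideanSpace ℝ (Fin 3)))⁻¹ ^ (2 * 6)) else 0))

/-- The hcp site value `Φ_hcp(a,h) = Σ'_{p ∈ hcpStacking a h} φ₆(‖p‖)`, exactly as in the crux. -/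
def hcpValue (a h : ℝ) : ℝ :=
  (∑' p : ↥(Literature.MathematicalPhysics.StatisticalMechanics.hcpStacking a h), (2 * (‖(p : EuclideanSpace ℝ (Fin 3))‖)⁻¹ ^ 6 - (‖(p : EuclideanSpace ℝ (Fin 3))‖)⁻¹ ^ (2 * 6)))

/-- Two-way `η`-matching of the closed `5a/3`-neighbourhood of `w` in `S` to the hcp(a,h) site environment up to a
linear isometry, exactly as in the crux (its coercivity clause is `¬ Matched → …`). -/
def Matched (a h η : ℝ) (S : Set (EuclideanSpace ℝ (Fin 3))) (w : (EuclideanSpace ℝ (Fin 3))) : Prop :=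
  (∃ A : EuclideanSpace ℝ (Fin 3) →ₗᵢ[ℝ] EuclideanSpace ℝ (Fin 3), (∀ p ∈ Literature.MathematicalPhysics.StatisticalMechanics.hcpStacking a h, ‖p‖ ≤ 5 / 3 * a → ∃ b ∈ S, dist b (w + A p) ≤ η) ∧ (∀ b ∈ S, dist b w ≤ 5 / 3 * a → ∃ p ∈ Literature.MathematicalPhysics.StatisticalMechanics.hcpStacking a h, dist b (w + A p) ≤ η))

/-- THE EXCESS FUNCTIONAL of the line: truncated one-centre value minus the coercive benchmark
`Φ_hcp(a,h) + ε − γ·[¬ Matched]`.  Positive part = surplus to be shipped away, negative part = deficit that can absorb. -/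
def excess (a h η γ ε R₁ : ℝ) (S : Set (EuclideanSpace ℝ (Fin 3))) (w : (EuclideanSpace ℝ (Fin 3))) : ℝ :=
  truncSum R₁ S w - hcpValue a h - ε + (if Matched a h η S w then 0 else γ)

/-! ## Translation bookkeeping (proved): the excess functional is LOCAL -/

theorem dist_sub_eq_dist_add_right (a b c : (EuclideanSpace ℝ (Fin 3))) : dist (a - b) c = dist a (c + b) := by
  rw [dist_eq_norm, dist_eq_norm]; congr 1; abel

theorem dist_sub_sub_add (z x y w : (EuclideanSpace ℝ (Fin 3))) : dist (z - x) (y - x + w) = dist z (y + w) := by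
  rw [dist_eq_norm, dist_eq_norm]; congr 1; abel

theorem dist_sub_sub (z x y : (EuclideanSpace ℝ (Fin 3))) : dist (z - x) (y - x) = dist z y := by
  rw [dist_eq_norm, dist_eq_norm]; congr 1; abel

theorem mem_env_iff {S : Set (EuclideanSpace ℝ (Fin 3))} {x u : (EuclideanSpace ℝ (Fin 3))} {R : ℝ} :
    u ∈ env S x R ↔ u + x ∈ S ∧ ‖u‖ ≤ R := by
  simp only [env, Set.mem_inter_iff, Set.mem_image, Metric.mem_closedBall, dist_zero_right]
  constructor
  · rintro ⟨⟨z, hz, rfl⟩, hu⟩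
    exact ⟨by simpa using hz, hu⟩
  · rintro ⟨hu, hR⟩
    exact ⟨⟨u + x, hu, by simp⟩, hR⟩

theorem sub_mem_env {S : Set (EuclideanSpace ℝ (Fin 3))} {x z : (EuclideanSpace ℝ (Fin 3))} {R : ℝ} (hz : z ∈ S) (h : dist z x ≤ R) :
    z - x ∈ env S x R := by
  rw [mem_env_iff, sub_add_cancel, ← dist_eq_norm]
  exact ⟨hz, h⟩

/-- Reindexing a translation: a radial sum centred at `y ∈ ℝ³` over `S`, supported in the ball of radius `R₁` about `y`,
equals the same sum centred at `y − x` over the recentred environment `env S x R`, provided `dist x y + R₁ ≤ R`. -/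
theorem tsum_radial_env (S : Set (EuclideanSpace ℝ (Fin 3))) (x y : (EuclideanSpace ℝ (Fin 3))) (R₁ R : ℝ) (F : ℝ → ℝ) (hF : ∀ r, R₁ < r → F r = 0)
    (h : dist x y + R₁ ≤ R) :
    ∑' b : ↥S, F (dist y (b : (EuclideanSpace ℝ (Fin 3)))) = ∑' u : ↥(env S x R), F (dist (y - x) (u : (EuclideanSpace ℝ (Fin 3)))) := by
  have hmem : ∀ u : ↥(env S x R), (u : (EuclideanSpace ℝ (Fin 3))) + x ∈ S := fun u => (mem_env_iff.1 u.2).1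
  have hinj : Function.Injective (fun u : ↥(env S x R) => (⟨(u : (EuclideanSpace ℝ (Fin 3))) + x, hmem u⟩ : ↥S)) := by
    intro u v huv
    apply Subtype.ext
    have := congrArg (fun b : ↥S => (b : (EuclideanSpace ℝ (Fin 3)))) huv
    simpa using this
  have hsupp : Function.support (fun b : ↥S => F (dist y (b : (EuclideanSpace ℝ (Fin 3))))) ⊆
      Set.range (fun u : ↥(env S x R) => (⟨(u : (EuclideanSpace ℝ (Fin 3))) + x, hmem u⟩ : ↥S)) := by
    intro b hb
    rw [Function.mem_support] at hb
    have hle : dist y (b : (EuclideanSpace ℝ (Fin 3))) ≤ R₁ := by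
      by_contra hgt
      exact hb (hF _ (lt_of_not_ge hgt))
    have hbx : dist (b : (EuclideanSpace ℝ (Fin 3))) x ≤ R := by
      have := dist_triangle (b : (EuclideanSpace ℝ (Fin 3))) y x
      rw [dist_comm (b : (EuclideanSpace ℝ (Fin 3))) y] at this
      linarith [dist_comm x y]
    refine ⟨⟨(b : (EuclideanSpace ℝ (Fin 3))) - x, sub_mem_env b.2 hbx⟩, ?_⟩
    apply Subtype.ext
    simp
  rw [← hinj.tsum_eq hsupp]
  refine tsum_congr fun u => ?_
  simp only [dist_sub_eq_dist_add_right]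

/-- LOCALITY OF THE TRUNCATED SUM: `Φ^{≤R₁}_S(y) = Φ^{≤R₁}_{env S x R}(y − x)` whenever `dist x y + R₁ ≤ R`. -/
theorem truncSum_local (S : Set (EuclideanSpace ℝ (Fin 3))) (x y : (EuclideanSpace ℝ (Fin 3))) (R₁ R : ℝ) (h : dist x y + R₁ ≤ R) :
    truncSum R₁ S y = truncSum R₁ (env S x R) (y - x) := by
  unfold truncSum
  exact tsum_radial_env S x y R₁ R (fun r => if r ≤ R₁ then (2 * r⁻¹ ^ 6 - r⁻¹ ^ (2 * 6)) else 0)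
    (fun r hr => if_neg (not_le.2 hr)) h

/-- LOCALITY OF THE MATCHING PREDICATE: `η`-matching at `y` in `S` is `η`-matching at `y − x` in `env S x R` whenever
`dist x y + 5a/3 + η ≤ R` (`η ≥ 0`). -/
theorem matched_local (S : Set (EuclideanSpace ℝ (Fin 3))) (x y : (EuclideanSpace ℝ (Fin 3))) (a h η R : ℝ) (hη : 0 ≤ η)
    (hR : dist x y + 5 / 3 * a + η ≤ R) :
    Matched a h η S y ↔ Matched a h η (env S x R) (y - x) := by
  unfold Matched
  constructor
  · rintro ⟨A, h₁, h₂⟩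
    refine ⟨A, fun p hp hpn => ?_, fun u hu hud => ?_⟩
    · obtain ⟨b, hb, hbd⟩ := h₁ p hp hpn
      refine ⟨b - x, sub_mem_env hb ?_, by rwa [dist_sub_sub_add]⟩
      have h3 : dist b x ≤ dist b (y + A p) + dist (y + A p) y + dist y x := dist_triangle4 _ _ _ _
      have h4 : dist (y + A p) y = ‖p‖ := by
        rw [dist_eq_norm, add_sub_cancel_left, A.norm_map]
      rw [h4] at h3
      linarith [dist_comm x y]
    · have hu' := (mem_env_iff.1 hu).1
      have hd : dist (u + x) y ≤ 5 / 3 * a := by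
        have : dist (u + x - x) (y - x) = dist (u + x) y := dist_sub_sub _ _ _
        rw [add_sub_cancel_right] at this
        rwa [this] at hud
      obtain ⟨p, hp, hpd⟩ := h₂ (u + x) hu' hd
      refine ⟨p, hp, ?_⟩
      have : dist (u + x - x) (y - x + A p) = dist (u + x) (y + A p) := dist_sub_sub_add _ _ _ _
      rw [add_sub_cancel_right] at this
      rwa [this]
  · rintro ⟨A, h₁, h₂⟩
    refine ⟨A, fun p hp hpn => ?_, fun b hb hbd => ?_⟩
    · obtain ⟨u, hu, hud⟩ := h₁ p hp hpn
      refine ⟨u + x, (mem_env_iff.1 hu).1, ?_⟩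
      have : dist (u + x - x) (y - x + A p) = dist (u + x) (y + A p) := dist_sub_sub_add _ _ _ _
      rw [add_sub_cancel_right] at this
      rwa [this] at hud
    · have hbx : dist b x ≤ R := by
        have := dist_triangle b y x
        linarith [dist_comm x y]
      obtain ⟨p, hp, hpd⟩ := h₂ (b - x) (sub_mem_env hb hbx) (by rwa [dist_sub_sub])
      exact ⟨p, hp, by rwa [dist_sub_sub_add] at hpd⟩

/-- LOCALITY OF THE EXCESS FUNCTIONAL (radius `2ρ`, reading environments of radius `R`): the hypothesis of the
transportation lemma `stub_transfer`, for the concrete functional of `stub_ledger`. -/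
theorem excess_local (S : Set (EuclideanSpace ℝ (Fin 3))) (x y : (EuclideanSpace ℝ (Fin 3))) (a h η γ ε R₁ R : ℝ) (hη : 0 ≤ η)
    (h₁ : dist x y + R₁ ≤ R) (h₂ : dist x y + 5 / 3 * a + η ≤ R) :
    excess a h η γ ε R₁ S y = excess a h η γ ε R₁ (env S x R) (y - x) := by
  unfold excess
  rw [truncSum_local S x y R₁ R h₁]
  by_cases hm : Matched a h η S y
  · rw [if_pos hm, if_pos ((matched_local S x y a h η R hη h₂).1 hm)]
  · rw [if_neg hm, if_neg (fun h' => hm ((matched_local S x y a h η R hη h₂).2 h'))]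

/-! ## Registered stubs (the ONLY `sorry`s of this file; one-line, fully qualified signatures) -/

/-- **STUB 1 — `stub_ledger`: THE PROPORTIONAL SURPLUS/DEFICIT LEDGER AT EXPONENT 6** (XL / open; carries the physics
of the crux).  There is an hcp scale `(a,h)` in the window `2a < 3h, 6h < 5a` such that for every `η > 0` there is a
gain `γ > 0`, and for every tolerance `ε > 0` and every `R₀` a sharing radius `ρ > 0` and a truncation radius `R₁ ≥ R₀`,
such that on every `(2/3)`-separated `S ⊂ ℝ³`, writing `Ψ(w) = Φ^{≤R₁}_S(w) − Φ_hcp(a,h) − ε + γ·[w not η-matched]`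
(the EXCESS of the centre `w` over the coercive benchmark), every centre `x` with a SURPLUS `Ψ(x) > 0` sees, within
distance `ρ`, enough DEFICIT discounted by the surplus competing for it:
`1 ≤ Σ_{y ∈ S, 0 < |y−x| ≤ ρ} (−Ψ(y))₊ / Σ_{z ∈ S, 0 < |z−y| ≤ ρ} (Ψ(z))₊`
— exactly the solvability condition of the ONE-ROUND deficit-driven proportional transfer (`stub_transfer`).  It implies
the crux (this file) and is implied by nothing weaker that is known; under-coordinated, stretched or crammed
(`|b| < 0.89`, `φ₆ < 0`) neighbours carry `O(1)`–`O(100)` deficits, surplus needs `≥ 13` near-unit bonds or a deep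
second shell.  WHY IT MIGHT FAIL: (i) the crux's own risk — at `q = 6` a mildly crammed 13–14-fold or Frank–Kasper
centre may carry surplus while every neighbour within any fixed `ρ` is itself benchmark-neutral (deficit only `≈ ε`),
and `γ(η)` is capped by the silent fcc/hcp second-shell split (`≲ 6e-4·Φ`); (ii) specific to this stub — one round of
proportional sharing at a single radius may be too rigid where deficit must be RELAYED over several hops (then iterate
the transportation lemma: k rounds = k-fold composition, a new line, not a patch).  Sources: FlatleyTheil2015 (one-step
redistribution, d = 3 with V₃), HeitmannRadin1980 / Theil2006 (one-centre counting), HalesDSP2012 Lemma 6.95 (local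
annulus inequality with one correction), BlancLewin2015 §2–3 (status at q = 6). -/
theorem stub_ledger : ∃ a h : ℝ, 0 < a ∧ 0 < h ∧ 2 * a < 3 * h ∧ 6 * h < 5 * a ∧ ∀ η : ℝ, 0 < η → ∃ γ : ℝ, 0 < γ ∧ ∀ ε : ℝ, 0 < ε → ∀ R₀ : ℝ, ∃ ρ R₁ : ℝ, 0 < ρ ∧ R₀ ≤ R₁ ∧ ∀ S : Set (EuclideanSpace ℝ (Fin 3)), (∀ x ∈ S, ∀ y ∈ S, x ≠ y → 2 / 3 ≤ dist x y) → ∀ x ∈ S, 0 < ((∑' b : ↥S, (if dist x (b : EuclideanSpace ℝ (Fin 3)) ≤ R₁ then (2 * (dist x (b : EuclideanSpace ℝ (Fin 3)))⁻¹ ^ 6 - (dist x (b : EuclideanSpace ℝ (Fin 3)))⁻¹ ^ (2 * 6)) else 0)) - (∑' p : ↥(Literature.MathematicalPhysics.StatisticalMechanics.hcpStacking a h), (2 * (‖(p : EuclideanSpace ℝ (Fin 3))‖)⁻¹ ^ 6 - (‖(p : EuclideanSpace ℝ (Fin 3))‖)⁻¹ ^ (2 * 6))) - ε + (if (∃ A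 : EuclideanSpace ℝ (Fin 3) →ₗᵢ[ℝ] EuclideanSpace ℝ (Fin 3), (∀ p ∈ Literature.MathematicalPhysics.StatisticalMechanics.hcpStacking a h, ‖p‖ ≤ 5 / 3 * a → ∃ b ∈ S, dist b (x + A p) ≤ η) ∧ (∀ b ∈ S, dist b x ≤ 5 / 3 * a → ∃ p ∈ Literature.MathematicalPhysics.StatisticalMechanics.hcpStacking a h, dist b (x + A p) ≤ η)) then 0 else γ)) → 1 ≤ ∑' y : ↥S, (if 0 < dist x (y : EuclideanSpace ℝ (Fin 3)) ∧ dist x (y : EuclideanSpace ℝ (Fin 3)) ≤ ρ then max (- ((∑' b : ↥S, (if dist (y : EuclideanSpace ℝ (Fin 3)) (b : EuclideanSpace ℝ (Fin 3)) ≤ R₁ then (2 * (dist (y : EuclideanSpace ℝ (Fin 3)) (b : EuclideanSpace ℝ (Fin 3)))⁻¹ ^ 6 - (dist (y : EuclideanSpace ℝ (Fin 3)) (b : EuclideanSpace ℝ (Fin 3)))⁻¹ ^ (2 * 6)) else 0)) - (∑' p : ↥(Literature.MathematicalPhysics.StatisticalMechanics.hcpStacking a h), (2 * (‖(p : EuclideanSpace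 ℝ (Fin 3))‖)⁻¹ ^ 6 - (‖(p : EuclideanSpace ℝ (Fin 3))‖)⁻¹ ^ (2 * 6))) - ε + (if (∃ A : EuclideanSpace ℝ (Fin 3) →ₗᵢ[ℝ] EuclideanSpace ℝ (Fin 3), (∀ p ∈ Literature.MathematicalPhysics.StatisticalMechanics.hcpStacking a h, ‖p‖ ≤ 5 / 3 * a → ∃ b ∈ S, dist b ((y : EuclideanSpace ℝ (Fin 3)) + A p) ≤ η) ∧ (∀ b ∈ S, dist b (y : EuclideanSpace ℝ (Fin 3)) ≤ 5 / 3 * a → ∃ p ∈ Literature.MathematicalPhysics.StatisticalMechanics.hcpStacking a h, dist b ((y : EuclideanSpace ℝ (Fin 3)) + A p) ≤ η)) then 0 else γ))) 0 / (∑' z : ↥S, (if 0 < dist (y : EuclideanSpace ℝ (Fin 3)) (z : EuclideanSpace ℝ (Fin 3)) ∧ dist (y : EuclideanSpace ℝ (Fin 3)) (z : EuclideanSpace ℝ (Fin 3)) ≤ ρ then max (((∑' b : ↥S, (if dist (z : EuclideanSpace ℝ (Fin 3)) (b : EuclideanSpace ℝ (Fin 3)) ≤ R₁ then (2 * (dist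 (z : EuclideanSpace ℝ (Fin 3)) (b : EuclideanSpace ℝ (Fin 3)))⁻¹ ^ 6 - (dist (z : EuclideanSpace ℝ (Fin 3)) (b : EuclideanSpace ℝ (Fin 3)))⁻¹ ^ (2 * 6)) else 0)) - (∑' p : ↥(Literature.MathematicalPhysics.StatisticalMechanics.hcpStacking a h), (2 * (‖(p : EuclideanSpace ℝ (Fin 3))‖)⁻¹ ^ 6 - (‖(p : EuclideanSpace ℝ (Fin 3))‖)⁻¹ ^ (2 * 6))) - ε + (if (∃ A : EuclideanSpace ℝ (Fin 3) →ₗᵢ[ℝ] EuclideanSpace ℝ (Fin 3), (∀ p ∈ Literature.MathematicalPhysics.StatisticalMechanics.hcpStacking a h, ‖p‖ ≤ 5 / 3 * a → ∃ b ∈ S, dist b ((z : EuclideanSpace ℝ (Fin 3)) + A p) ≤ η) ∧ (∀ b ∈ S, dist b (z : EuclideanSpace ℝ (Fin 3)) ≤ 5 / 3 * a → ∃ p ∈ Literature.MathematicalPhysics.StatisticalMechanics.hcpStacking a h, dist b ((z : EuclideanSpace ℝ (Fin 3)) + A p) ≤ η)) then 0 else γ))) 0 else 0)) else 0) := by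
  sorry

/-- **STUB 2 — `stub_transfer`: THE LOCAL TRANSPORTATION LEMMA** (M; a theorem — the combinatorics of one-round
proportional sharing, stated for an ABSTRACT excess functional).  Let `δ, ρ > 0`, `2ρ ≤ R`, and let
`Ψ : Set ℝ³ → ℝ³ → ℝ` be LOCAL at radius `2ρ` through range-`R` environments on `δ`-separated sets
(`Ψ S y = Ψ ((S − x) ∩ B̄_R) (y − x)` whenever `x, y ∈ S`, `|x − y| ≤ 2ρ`).  If the proportional ledger condition of
`stub_ledger` holds for `Ψ` on every `δ`-separated `S`, then there is ONE rule `g(v, U)` of range `ρ`, antisymmetric on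
every `δ`-separated `S` in exactly the crux's sense (`g(y−x, U_x) = −g(x−y, U_y)`), with `Ψ S x + Σ'_{y∈S} g(y−x, U_x) ≤ 0`
at every centre.  PROOF PLAN (the rule): a deficit centre `y` hands to each surplus centre `x` with `0 < |x−y| ≤ ρ` the
share `(−Ψ y)₊ (Ψ x)₊ / Σ_{0<|z−y|≤ρ} (Ψ z)₊`; computed from `U_x` alone by locality (all points involved lie within `2ρ ≤ R`
of `x`), antisymmetric by construction, a deficit centre never pays more than its deficit (`Σ/Σ ∈ {0,1}`, Lean's `x/0 = 0`
matches the ledger's convention), and a surplus centre receives `(Ψ x)₊ · (ledger sum) ≥ (Ψ x)₊`; all sums are finite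
because a `δ`-separated set meets every ball in finitely many points.  WHY IT MIGHT FAIL: only through a typing slip
(it is a theorem); size M: finiteness of separated sets in balls, `tsum` = finite sum, case split on the sign of `Ψ S x`.
Sources: HalesDSP2012 (Lemma 6.95 architecture), FlatleyTheil2015 §4 (redistribution of energy contributions). -/
theorem stub_transfer : ∀ δ ρ R : ℝ, 0 < δ → 0 < ρ → 2 * ρ ≤ R → ∀ Ψ : Set (EuclideanSpace ℝ (Fin 3)) → EuclideanSpace ℝ (Fin 3) → ℝ, (∀ S : Set (EuclideanSpace ℝ (Fin 3)), (∀ x ∈ S, ∀ y ∈ S, x ≠ y → δ ≤ dist x y) → ∀ x ∈ S, ∀ y ∈ S, dist x y ≤ 2 * ρ → Ψ S y = Ψ (((fun z : EuclideanSpace ℝ (Fin 3) => z - x) '' S) ∩ Metric.closedBall (0 : EuclideanSpace ℝ (Fin 3)) R) (y - x)) → (∀ S : Set (EuclideanSpace ℝ (Fin 3)), (∀ x ∈ S, ∀ y ∈ S, x ≠ y → δ ≤ dist x y) → ∀ x ∈ S, 0 < Ψ S x → 1 ≤ ∑' y : ↥S, (if 0 < dist x (y : EuclideanSpace ℝ (Fin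 3)) ∧ dist x (y : EuclideanSpace ℝ (Fin 3)) ≤ ρ then max (- Ψ S (y : EuclideanSpace ℝ (Fin 3))) 0 / (∑' z : ↥S, (if 0 < dist (y : EuclideanSpace ℝ (Fin 3)) (z : EuclideanSpace ℝ (Fin 3)) ∧ dist (y : EuclideanSpace ℝ (Fin 3)) (z : EuclideanSpace ℝ (Fin 3)) ≤ ρ then max (Ψ S (z : EuclideanSpace ℝ (Fin 3))) 0 else 0)) else 0)) → ∃ g : EuclideanSpace ℝ (Fin 3) → Set (EuclideanSpace ℝ (Fin 3)) → ℝ, (∀ (v : EuclideanSpace ℝ (Fin 3)) (U : Set (EuclideanSpace ℝ (Fin 3))), ρ < ‖v‖ → g v U = 0) ∧ ∀ S : Set (EuclideanSpace ℝ (Fin 3)), (∀ x ∈ S, ∀ y ∈ S, x ≠ y → δ ≤ dist x y) → (∀ x ∈ S, ∀ y ∈ S, g (y - x) (((fun z : EuclideanSpace ℝ (Fin 3) => z - x) '' S) ∩ Metric.closedBall (0 : EuclideanSpace ℝ (Fin 3)) R) = - g (x - y) (((fun z : EuclideanSpace ℝ (Fin 3) => z - y) '' S) ∩ Metric.closedBall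 (0 : EuclideanSpace ℝ (Fin 3)) R)) ∧ ∀ x ∈ S, Ψ S x + (∑' y : ↥S, g ((y : EuclideanSpace ℝ (Fin 3)) - x) (((fun z : EuclideanSpace ℝ (Fin 3) => z - x) '' S) ∩ Metric.closedBall (0 : EuclideanSpace ℝ (Fin 3)) R)) ≤ 0 := by
  sorry

/-- **STUB 3 — `stub_tail`: UNIFORM TRUNCATION TAIL ON `(2/3)`-SEPARATED SETS** (S/M; true, routine).  For every
`ε > 0` there is `R₁₀` such that for `R₁₀ ≤ R₁ ≤ R` and every centre `x` of every `(2/3)`-separated `S ⊂ ℝ³`,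
`Φ^{≤R}_S(x) ≤ Φ^{≤R₁}_S(x) + ε`: the shell `R₁ < |y − x| ≤ R` contributes `≤ Σ 2|y−x|⁻⁶ ≤ 2048/((2/3)³ R₁³)` by the landed
dyadic-shell bound `ExcessDecayLiouville.tsum_inv_pow_le_of_separated` (k = 3) and `phi_le_two_mul`; the `tsum`s over `↥S`
are finite sums (separation).  Kept as a stub only so that the proved part of this birth file is the composition; a
prover closes it from the two named tree lemmas.  WHY IT MIGHT FAIL: it cannot (theorem); formal size S–M.
Sources: tree `Summit.AtomisticToContinuum.Crystallization.Theorems.ExcessDecayLiouville.tsum_inv_pow_le_of_separated`,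
`…OneCentreSteepnessLadderZeroDensity.sum_phi_le_sum_ite_add` (the finite-configuration version, landed). -/
theorem stub_tail : ∀ ε : ℝ, 0 < ε → ∃ R₁₀ : ℝ, ∀ R₁ R : ℝ, R₁₀ ≤ R₁ → R₁ ≤ R → ∀ S : Set (EuclideanSpace ℝ (Fin 3)), (∀ x ∈ S, ∀ y ∈ S, x ≠ y → 2 / 3 ≤ dist x y) → ∀ x ∈ S, (∑' b : ↥S, (if dist x (b : EuclideanSpace ℝ (Fin 3)) ≤ R then (2 * (dist x (b : EuclideanSpace ℝ (Fin 3)))⁻¹ ^ 6 - (dist x (b : EuclideanSpace ℝ (Fin 3)))⁻¹ ^ (2 * 6)) else 0)) ≤ (∑' b : ↥S, (if dist x (b : EuclideanSpace ℝ (Fin 3)) ≤ R₁ then (2 * (dist x (b : EuclideanSpace ℝ (Fin 3)))⁻¹ ^ 6 - (dist x (b : EuclideanSpace ℝ (Fin 3)))⁻¹ ^ (2 * 6)) else 0)) + ε := by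
  sorry

/-! ## Composition (kernel-checked, sorry-free): the three stub statements imply the crux -/

/-- THE COMPOSITION, with the stub statements as hypotheses written through the readable names (definitionally the
registered one-line signatures) and the crux written through the same names (definitionally the route decl — see
`LJDominationTwoThirds_of`).  Given `η` take `γ` from the ledger; given `ε, R₀` take the tail radius `R₁₀(ε/2)`, then the
ledger's `ρ, R₁ ≥ max(R₀, R₁₀, 5a/3 + η)` at tolerance `ε/2`, and set `R := 2ρ + R₁`; the concrete excess functional is
local at radius `2ρ` through range-`R` environments (`excess_local`: reindexing of the radial sum under translation and
transport of the two-way matching, which reads only `B̄(x, 5a/3 + η)`), so the transportation lemma yields the rule `g`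
(range `ρ ≤ R`, antisymmetric verbatim); finally `Φ^{≤R} ≤ Φ^{≤R₁} + ε/2` (tail) and `excess + T_g ≤ 0` give
`Φ^{≤R} + T_g ≤ Φ_hcp + ε − γ·[¬ matched] ≤ Φ_hcp + ε`. -/
theorem compose
    (hL : ∃ a h : ℝ, 0 < a ∧ 0 < h ∧ 2 * a < 3 * h ∧ 6 * h < 5 * a ∧ ∀ η : ℝ, 0 < η → ∃ γ : ℝ, 0 < γ ∧
      ∀ ε : ℝ, 0 < ε → ∀ R₀ : ℝ, ∃ ρ R₁ : ℝ, 0 < ρ ∧ R₀ ≤ R₁ ∧ ∀ S : Set (EuclideanSpace ℝ (Fin 3)), Sep (2 / 3) S → ∀ x ∈ S,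
      0 < excess a h η γ ε R₁ S x → 1 ≤ ∑' y : ↥S, (if 0 < dist x (y : (EuclideanSpace ℝ (Fin 3))) ∧ dist x (y : (EuclideanSpace ℝ (Fin 3))) ≤ ρ then
        max (- excess a h η γ ε R₁ S (y : (EuclideanSpace ℝ (Fin 3)))) 0 / (∑' z : ↥S, (if 0 < dist (y : (EuclideanSpace ℝ (Fin 3))) (z : (EuclideanSpace ℝ (Fin 3))) ∧ dist (y : (EuclideanSpace ℝ (Fin 3))) (z : (EuclideanSpace ℝ (Fin 3))) ≤ ρ
          then max (excess a h η γ ε R₁ S (z : (EuclideanSpace ℝ (Fin 3)))) 0 else 0)) else 0))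
    (hT : ∀ δ ρ R : ℝ, 0 < δ → 0 < ρ → 2 * ρ ≤ R → ∀ Ψ : Set (EuclideanSpace ℝ (Fin 3)) → (EuclideanSpace ℝ (Fin 3)) → ℝ,
      (∀ S : Set (EuclideanSpace ℝ (Fin 3)), Sep δ S → ∀ x ∈ S, ∀ y ∈ S, dist x y ≤ 2 * ρ → Ψ S y = Ψ (env S x R) (y - x)) →
      (∀ S : Set (EuclideanSpace ℝ (Fin 3)), Sep δ S → ∀ x ∈ S, 0 < Ψ S x → 1 ≤ ∑' y : ↥S, (if 0 < dist x (y : (EuclideanSpace ℝ (Fin 3))) ∧ dist x (y : (EuclideanSpace ℝ (Fin 3))) ≤ ρ then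
        max (- Ψ S (y : (EuclideanSpace ℝ (Fin 3)))) 0 / (∑' z : ↥S, (if 0 < dist (y : (EuclideanSpace ℝ (Fin 3))) (z : (EuclideanSpace ℝ (Fin 3))) ∧ dist (y : (EuclideanSpace ℝ (Fin 3))) (z : (EuclideanSpace ℝ (Fin 3))) ≤ ρ
          then max (Ψ S (z : (EuclideanSpace ℝ (Fin 3)))) 0 else 0)) else 0)) →
      ∃ g : (EuclideanSpace ℝ (Fin 3)) → Set (EuclideanSpace ℝ (Fin 3)) → ℝ, (∀ (v : (EuclideanSpace ℝ (Fin 3))) (U : Set (EuclideanSpace ℝ (Fin 3))), ρ < ‖v‖ → g v U = 0) ∧ ∀ S : Set (EuclideanSpace ℝ (Fin 3)), Sep δ S →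
        (∀ x ∈ S, ∀ y ∈ S, g (y - x) (env S x R) = - g (x - y) (env S y R)) ∧
        ∀ x ∈ S, Ψ S x + (∑' y : ↥S, g ((y : (EuclideanSpace ℝ (Fin 3))) - x) (env S x R)) ≤ 0)
    (hTail : ∀ ε : ℝ, 0 < ε → ∃ R₁₀ : ℝ, ∀ R₁ R : ℝ, R₁₀ ≤ R₁ → R₁ ≤ R → ∀ S : Set (EuclideanSpace ℝ (Fin 3)), Sep (2 / 3) S → ∀ x ∈ S,
      truncSum R S x ≤ truncSum R₁ S x + ε) :
    ∃ a h : ℝ, 0 < a ∧ 0 < h ∧ 2 * a < 3 * h ∧ 6 * h < 5 * a ∧ (∀ η : ℝ, 0 < η → ∃ γ : ℝ, 0 < γ ∧ ∀ ε : ℝ, 0 < ε →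
      ∀ R₀ : ℝ, ∃ R : ℝ, R₀ ≤ R ∧ ∃ g : (EuclideanSpace ℝ (Fin 3)) → Set (EuclideanSpace ℝ (Fin 3)) → ℝ, (∀ (v : (EuclideanSpace ℝ (Fin 3))) (U : Set (EuclideanSpace ℝ (Fin 3))), R < ‖v‖ → g v U = 0) ∧
      ∀ S : Set (EuclideanSpace ℝ (Fin 3)), Sep (2 / 3) S → (∀ x ∈ S, ∀ y ∈ S, g (y - x) (env S x R) = - g (x - y) (env S y R)) ∧
      ∀ x ∈ S, (truncSum R S x + (∑' y : ↥S, g ((y : (EuclideanSpace ℝ (Fin 3))) - x) (env S x R)) ≤ hcpValue a h + ε) ∧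
        (¬ Matched a h η S x → truncSum R S x + (∑' y : ↥S, g ((y : (EuclideanSpace ℝ (Fin 3))) - x) (env S x R)) ≤ hcpValue a h + ε - γ)) := by
  obtain ⟨a, h, ha, hh, hw₁, hw₂, hled⟩ := hL
  refine ⟨a, h, ha, hh, hw₁, hw₂, ?_⟩
  intro η hη
  obtain ⟨γ, hγ, hled⟩ := hled η hη
  refine ⟨γ, hγ, ?_⟩
  intro ε hε R₀
  have hε2 : 0 < ε / 2 := half_pos hε
  obtain ⟨R₁₀, htail⟩ := hTail (ε / 2) hε2
  obtain ⟨ρ, R₁, hρ, hR₁, hQ⟩ := hled (ε / 2) hε2 (max (max R₀ R₁₀) (5 / 3 * a + η))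
  have hR₀R₁ : R₀ ≤ R₁ := le_trans (le_trans (le_max_left R₀ R₁₀) (le_max_left _ _)) hR₁
  have hR₁₀R₁ : R₁₀ ≤ R₁ := le_trans (le_trans (le_max_right R₀ R₁₀) (le_max_left _ _)) hR₁
  have haηR₁ : 5 / 3 * a + η ≤ R₁ := le_trans (le_max_right _ _) hR₁
  have hR₁nn : 0 ≤ R₁ := by linarith
  obtain ⟨g, hg0, hg⟩ := hT (2 / 3) ρ (2 * ρ + R₁) (by norm_num) hρ (by linarith) (excess a h η γ (ε / 2) R₁)
    (fun S _ x _ y _ hxy => excess_local S x y a h η γ (ε / 2) R₁ (2 * ρ + R₁) hη.le (by linarith) (by linarith)) hQ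
  refine ⟨2 * ρ + R₁, by linarith, g, fun v U hv => hg0 v U (by linarith), ?_⟩
  intro S hS
  obtain ⟨hanti, hdom⟩ := hg S hS
  refine ⟨hanti, fun x hx => ?_⟩
  have h1 := hdom x hx
  have h2 := htail R₁ (2 * ρ + R₁) hR₁₀R₁ (by linarith) S hS x hx
  have h3 : excess a h η γ (ε / 2) R₁ S x =
      truncSum R₁ S x - hcpValue a h - ε / 2 + (if Matched a h η S x then 0 else γ) := rfl
  rw [h3] at h1
  constructor
  · have hpen : 0 ≤ (if Matched a h η S x then (0 : ℝ) else γ) := by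
      split_ifs
      · exact le_rfl
      · exact hγ.le
    linarith
  · intro hnm
    rw [if_neg hnm] at h1
    linarith

/-- HYPOTHESIS FORM (BC3 letter; sorry-free): the three registered stub SIGNATURES, verbatim, imply the crux.
Kept as an `example` so that `LJDominationTwoThirds_of` is the file's only declaration concluding the crux by name. -/
example : (∃ a h : ℝ, 0 < a ∧ 0 < h ∧ 2 * a < 3 * h ∧ 6 * h < 5 * a ∧ ∀ η : ℝ, 0 < η → ∃ γ : ℝ, 0 < γ ∧ ∀ ε : ℝ, 0 < ε → ∀ R₀ : ℝ, ∃ ρ R₁ : ℝ, 0 < ρ ∧ R₀ ≤ R₁ ∧ ∀ S : Set (EuclideanSpace ℝ (Fin 3)), (∀ x ∈ S, ∀ y ∈ S, x ≠ y → 2 / 3 ≤ dist x y) → ∀ x ∈ S, 0 < ((∑' b : ↥S, (if dist x (b : EuclideanSpace ℝ (Fin 3)) ≤ R₁ then (2 * (dist x (b : EuclideanSpace ℝ (Fin 3)))⁻¹ ^ 6 - (dist x (b : EuclideanSpace ℝ (Fin 3)))⁻¹ ^ (2 * 6)) else 0)) - (∑' p : ↥(Literature.MathematicalPhysics.StatisticalMechanics.hcpStacking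 a h), (2 * (‖(p : EuclideanSpace ℝ (Fin 3))‖)⁻¹ ^ 6 - (‖(p : EuclideanSpace ℝ (Fin 3))‖)⁻¹ ^ (2 * 6))) - ε + (if (∃ A : EuclideanSpace ℝ (Fin 3) →ₗᵢ[ℝ] EuclideanSpace ℝ (Fin 3), (∀ p ∈ Literature.MathematicalPhysics.StatisticalMechanics.hcpStacking a h, ‖p‖ ≤ 5 / 3 * a → ∃ b ∈ S, dist b (x + A p) ≤ η) ∧ (∀ b ∈ S, dist b x ≤ 5 / 3 * a → ∃ p ∈ Literature.MathematicalPhysics.StatisticalMechanics.hcpStacking a h, dist b (x + A p) ≤ η)) then 0 else γ)) → 1 ≤ ∑' y : ↥S, (if 0 < dist x (y : EuclideanSpace ℝ (Fin 3)) ∧ dist x (y : EuclideanSpace ℝ (Fin 3)) ≤ ρ then max (- ((∑' b : ↥S, (if dist (y : EuclideanSpace ℝ (Fin 3)) (b : EuclideanSpace ℝ (Fin 3)) ≤ R₁ then (2 * (dist (y : EuclideanSpace ℝ (Fin 3)) (b : EuclideanSpace ℝ (Fin 3)))⁻¹ ^ 6 - (dist (y : EuclideanSpace ℝ (Fin 3))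 (b : EuclideanSpace ℝ (Fin 3)))⁻¹ ^ (2 * 6)) else 0)) - (∑' p : ↥(Literature.MathematicalPhysics.StatisticalMechanics.hcpStacking a h), (2 * (‖(p : EuclideanSpace ℝ (Fin 3))‖)⁻¹ ^ 6 - (‖(p : EuclideanSpace ℝ (Fin 3))‖)⁻¹ ^ (2 * 6))) - ε + (if (∃ A : EuclideanSpace ℝ (Fin 3) →ₗᵢ[ℝ] EuclideanSpace ℝ (Fin 3), (∀ p ∈ Literature.MathematicalPhysics.StatisticalMechanics.hcpStacking a h, ‖p‖ ≤ 5 / 3 * a → ∃ b ∈ S, dist b ((y : EuclideanSpace ℝ (Fin 3)) + A p) ≤ η) ∧ (∀ b ∈ S, dist b (y : EuclideanSpace ℝ (Fin 3)) ≤ 5 / 3 * a → ∃ p ∈ Literature.MathematicalPhysics.StatisticalMechanics.hcpStacking a h, dist b ((y : EuclideanSpace ℝ (Fin 3)) + A p) ≤ η)) then 0 else γ))) 0 / (∑' z : ↥S, (if 0 < dist (y : EuclideanSpace ℝ (Fin 3)) (z : EuclideanSpace ℝ (Fin 3)) ∧ dist (y : EuclideanSpace ℝ (Fin 3)) (z :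 EuclideanSpace ℝ (Fin 3)) ≤ ρ then max (((∑' b : ↥S, (if dist (z : EuclideanSpace ℝ (Fin 3)) (b : EuclideanSpace ℝ (Fin 3)) ≤ R₁ then (2 * (dist (z : EuclideanSpace ℝ (Fin 3)) (b : EuclideanSpace ℝ (Fin 3)))⁻¹ ^ 6 - (dist (z : EuclideanSpace ℝ (Fin 3)) (b : EuclideanSpace ℝ (Fin 3)))⁻¹ ^ (2 * 6)) else 0)) - (∑' p : ↥(Literature.MathematicalPhysics.StatisticalMechanics.hcpStacking a h), (2 * (‖(p : EuclideanSpace ℝ (Fin 3))‖)⁻¹ ^ 6 - (‖(p : EuclideanSpace ℝ (Fin 3))‖)⁻¹ ^ (2 * 6))) - ε + (if (∃ A : EuclideanSpace ℝ (Fin 3) →ₗᵢ[ℝ] EuclideanSpace ℝ (Fin 3), (∀ p ∈ Literature.MathematicalPhysics.StatisticalMechanics.hcpStacking a h, ‖p‖ ≤ 5 / 3 * a → ∃ b ∈ S, dist b ((z : EuclideanSpace ℝ (Fin 3)) + A p) ≤ η) ∧ (∀ b ∈ S, dist b (z : EuclideanSpace ℝ (Fin 3)) ≤ 5 / 3 *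 a → ∃ p ∈ Literature.MathematicalPhysics.StatisticalMechanics.hcpStacking a h, dist b ((z : EuclideanSpace ℝ (Fin 3)) + A p) ≤ η)) then 0 else γ))) 0 else 0)) else 0)) → (∀ δ ρ R : ℝ, 0 < δ → 0 < ρ → 2 * ρ ≤ R → ∀ Ψ : Set (EuclideanSpace ℝ (Fin 3)) → EuclideanSpace ℝ (Fin 3) → ℝ, (∀ S : Set (EuclideanSpace ℝ (Fin 3)), (∀ x ∈ S, ∀ y ∈ S, x ≠ y → δ ≤ dist x y) → ∀ x ∈ S, ∀ y ∈ S, dist x y ≤ 2 * ρ → Ψ S y = Ψ (((fun z : EuclideanSpace ℝ (Fin 3) => z - x) '' S) ∩ Metric.closedBall (0 : EuclideanSpace ℝ (Fin 3)) R) (y - x)) → (∀ S : Set (EuclideanSpace ℝ (Fin 3)), (∀ x ∈ S, ∀ y ∈ S, x ≠ y → δ ≤ dist x y) → ∀ x ∈ S, 0 < Ψ S x → 1 ≤ ∑' y : ↥S, (if 0 < dist x (y : EuclideanSpace ℝ (Fin 3)) ∧ dist x (y : EuclideanSpace ℝ (Fin 3)) ≤ ρ then max (- Ψ S (y : EuclideanSpace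 ℝ (Fin 3))) 0 / (∑' z : ↥S, (if 0 < dist (y : EuclideanSpace ℝ (Fin 3)) (z : EuclideanSpace ℝ (Fin 3)) ∧ dist (y : EuclideanSpace ℝ (Fin 3)) (z : EuclideanSpace ℝ (Fin 3)) ≤ ρ then max (Ψ S (z : EuclideanSpace ℝ (Fin 3))) 0 else 0)) else 0)) → ∃ g : EuclideanSpace ℝ (Fin 3) → Set (EuclideanSpace ℝ (Fin 3)) → ℝ, (∀ (v : EuclideanSpace ℝ (Fin 3)) (U : Set (EuclideanSpace ℝ (Fin 3))), ρ < ‖v‖ → g v U = 0) ∧ ∀ S : Set (EuclideanSpace ℝ (Fin 3)), (∀ x ∈ S, ∀ y ∈ S, x ≠ y → δ ≤ dist x y) → (∀ x ∈ S, ∀ y ∈ S, g (y - x) (((fun z : EuclideanSpace ℝ (Fin 3) => z - x) '' S) ∩ Metric.closedBall (0 : EuclideanSpace ℝ (Fin 3)) R) = - g (x - y) (((fun z : EuclideanSpace ℝ (Fin 3) => z - y) '' S) ∩ Metric.closedBall (0 : EuclideanSpace ℝ (Fin 3)) R)) ∧ ∀ x ∈ S, Ψ S x + (∑' y : ↥S,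 g ((y : EuclideanSpace ℝ (Fin 3)) - x) (((fun z : EuclideanSpace ℝ (Fin 3) => z - x) '' S) ∩ Metric.closedBall (0 : EuclideanSpace ℝ (Fin 3)) R)) ≤ 0) → (∀ ε : ℝ, 0 < ε → ∃ R₁₀ : ℝ, ∀ R₁ R : ℝ, R₁₀ ≤ R₁ → R₁ ≤ R → ∀ S : Set (EuclideanSpace ℝ (Fin 3)), (∀ x ∈ S, ∀ y ∈ S, x ≠ y → 2 / 3 ≤ dist x y) → ∀ x ∈ S, (∑' b : ↥S, (if dist x (b : EuclideanSpace ℝ (Fin 3)) ≤ R then (2 * (dist x (b : EuclideanSpace ℝ (Fin 3)))⁻¹ ^ 6 - (dist x (b : EuclideanSpace ℝ (Fin 3)))⁻¹ ^ (2 * 6)) else 0)) ≤ (∑' b : ↥S, (if dist x (b : EuclideanSpace ℝ (Fin 3)) ≤ R₁ then (2 * (dist x (b : EuclideanSpace ℝ (Fin 3)))⁻¹ ^ 6 - (dist x (b : EuclideanSpace ℝ (Fin 3)))⁻¹ ^ (2 * 6)) else 0)) + ε) →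
    Summit.AtomisticToContinuum.Crystallization.Theses.OneCentreSteepnessLadder.LJDominationTwoThirds :=
  fun hL hT hTail => compose hL hT hTail

/-- THE SKELETON THEOREM (registered form): concludes the route decl `LJDominationTwoThirds` BY NAME, takes no
hypotheses, and reaches `sorry` only through the three declared `stub_*`:
`LJDominationTwoThirds_of = compose stub_ledger stub_transfer stub_tail`. -/
theorem LJDominationTwoThirds_of :
    Summit.AtomisticToContinuum.Crystallization.Theses.OneCentreSteepnessLadder.LJDominationTwoThirds :=
  compose stub_ledger stub_transfer stub_tail

/-! ## Sanity: the readable names ARE the inlined expressions of the registered signatures (definitional) -/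

example (R₁ : ℝ) (S : Set (EuclideanSpace ℝ (Fin 3))) (w : (EuclideanSpace ℝ (Fin 3))) : truncSum R₁ S w = (∑' b : ↥S, (if dist w (b : EuclideanSpace ℝ (Fin 3)) ≤ R₁ then (2 * (dist w (b : EuclideanSpace ℝ (Fin 3)))⁻¹ ^ 6 - (dist w (b : EuclideanSpace ℝ (Fin 3)))⁻¹ ^ (2 * 6)) else 0)) := rfl

example (a h : ℝ) : hcpValue a h = (∑' p : ↥(Literature.MathematicalPhysics.StatisticalMechanics.hcpStacking a h), (2 * (‖(p : EuclideanSpace ℝ (Fin 3))‖)⁻¹ ^ 6 - (‖(p : EuclideanSpace ℝ (Fin 3))‖)⁻¹ ^ (2 * 6))) := rfl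

example (a h η : ℝ) (S : Set (EuclideanSpace ℝ (Fin 3))) (w : (EuclideanSpace ℝ (Fin 3))) : Matched a h η S w ↔ (∃ A : EuclideanSpace ℝ (Fin 3) →ₗᵢ[ℝ] EuclideanSpace ℝ (Fin 3), (∀ p ∈ Literature.MathematicalPhysics.StatisticalMechanics.hcpStacking a h, ‖p‖ ≤ 5 / 3 * a → ∃ b ∈ S, dist b (w + A p) ≤ η) ∧ (∀ b ∈ S, dist b w ≤ 5 / 3 * a → ∃ p ∈ Literature.MathematicalPhysics.StatisticalMechanics.hcpStacking a h, dist b (w + A p) ≤ η)) := Iff.rfl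

example (S : Set (EuclideanSpace ℝ (Fin 3))) (x : (EuclideanSpace ℝ (Fin 3))) (R : ℝ) : env S x R = (((fun z : EuclideanSpace ℝ (Fin 3) => z - x) '' S) ∩ Metric.closedBall (0 : EuclideanSpace ℝ (Fin 3)) R) := rfl

example (S : Set (EuclideanSpace ℝ (Fin 3))) : Sep (2 / 3) S ↔ (∀ x ∈ S, ∀ y ∈ S, x ≠ y → 2 / 3 ≤ dist x y) := Iff.rfl

end Summit.AtomisticToContinuum.Crystallization.Cruxes.LJDominationTwoThirds.Birth

end
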